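import Mathlib
import HarnessLib
import Summits.NavierStokesRegularity.NavierStokesRegularity.Theses.TaoLadderRungTwoBreak
import Summits.NavierStokesRegularity.NavierStokesRegularity.Theses.TaoLadderRungTwo
import Literature.Analysis.FluidPDE.Tao2016AveragedNS.BoundedEternalSolutions

/-!
# Cruxes ⟨20419⟩ `NoSurvivingEternalViscBddOne` and ⟨20420⟩ `EternalRigidityViscBddOne` (route TaoLadderRungTwoBreak):
# THE RUNG-TWO DUEL BY NAME — the two rung-M₂ routes decide each other, and the single open leaf
# `TaoLadderRungTwo.ComparableGapCertificatesV2` of the opposing route refutes the pair ⟨20419⟩ ∧ ⟨20420⟩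

MODEL lattice ODEs only (Tao 2016 §4, log-time variables of §6.4); nothing in this file is a statement about the
Navier–Stokes equations, and no summit, rung leaf or crux is proved here (`--supports stmt-NavierStokesRegularity-20419`,
pure logic over the two route files; imports no Theorems module — theses-cone hygiene).

The route text of `TaoLadderRungTwoBreak` records the kernel link `not_rungTwoLatt_of_target : Target → ¬ TaoLadderRungTwo.Target`
only in the cell package (HOME/rung2/…/GlueSelfcheck.lean); this file lands it in the tree together with its by-name
consequences for the items of this route:

* `not_rungTwoTarget_of_target`, `not_target_of_rungTwoTarget` — the rung leaves TL-M2Break (`TaoLadderRungTwoBreak.Target`: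
  below a spread-dependent threshold NO comparable table blows up robustly) and TL-M2 (`TaoLadderRungTwo.Target`: at some
  fixed spread SOME comparable table blows up robustly at every small scale ratio) are contradictory.
* `rungTwoTarget_of_gapCertificatesV2` — the opposing route is one leaf from its target: its deciding theorem `closes` with
  the in-file `GappedFrontRobustV2_holds` and its three CLOSED supports `RestartControl`, `RestartGlue`,
  `LocalDynamicsSufficesAt` (kept here as named hypotheses — they are discharged in the tree by
  `taoLadderRungTwo_restartControl_proof`, `taoLadderRungTwo_restartGlue_proof`, `taoLadderRungTwo_localDynamicsSufficesAt_proof`,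
  whose modules import a third route file and are therefore not imported here, theses-cone hygiene) leaves only
  `ComparableGapCertificatesV2` (the uniform certified gap-data family K_A₂) open.
* `not_pair_of_rungTwoTarget`, `not_pair_of_gapCertificatesV2`, `rungTwoTarget_imp_not_or` — KILL TEST BY NAME for this
  route's deciding pair: TL-M2 (hence K_A₂ with the three closed supports) refutes
  `NoSurvivingEternalViscBddOne ∧ EternalRigidityViscBddOne` (via the route's `closes`), i.e. makes at least one of ⟨20419⟩,
  ⟨20420⟩ false; `not_split_of_gapCertificatesV2` — the same for the split children (ρ0) `NoSurvivingEternalBddOne`, (ρ+)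
  `NoLoudLadderOne` with ⟨20420⟩ (the glue is the tree's `TaoCascade.noSurvivingEternalViscBddOne_of`, as in the landed
  `taoLadderRungTwoBreak_noSurvivingEternalViscBddOneOfSplit_proof`); `not_oldPair_of_rungTwoTarget` — and for the rev-1 pair
  `NoSurvivingDSSOne ∧ BlowupRigidityOne` (the rev-1 assembly, re-derived inline as in the landed
  `taoLadderRungTwoBreak_assembly_proof`).
* `not_gapCertificatesV2_of_pair` — conversely, proving ⟨20419⟩ and ⟨20420⟩ refutes K_A₂ by name (given the closed supports).

HONEST LABEL: route-duel bookkeeping; every crux named here stays OPEN; rung 0.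
-/

noncomputable section

-- the summit and its single sub-problem share the name (CONVENTIONS §1)
set_option linter.dupNamespace false

namespace Summit.NavierStokesRegularity.NavierStokesRegularity.Theorems.TaoLadderRungTwoBreakDuel

open Summit.NavierStokesRegularity.NavierStokesRegularity.Theses

/-- **The two rung-M₂ leaves are contradictory (break ⇒ ¬ blow-up).**  If below a threshold `εR(R)` no table of
`InTableClass R` blows up robustly, for every `R ≥ 1` (`TaoLadderRungTwoBreak.Target`), then there is no spread `R ≥ 1` at
which some comparable table blows up robustly at every small scale ratio (`TaoLadderRungTwo.Target`): at the witness spread,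
take `ε₀ = min εR εs`.
[cite: Tao2016AveragedNS, §4 Thm. 4.2 (statement shape of `NoGlobalCascade`); the two route files] -/
theorem not_rungTwoTarget_of_target (h : TaoLadderRungTwoBreak.Target) : ¬ TaoLadderRungTwo.Target := by
  rintro ⟨R, hR, εs, hεs, -, hall⟩
  obtain ⟨εR, hεR, hnone⟩ := h R hR
  obtain ⟨α, X₀, hα, hNG⟩ := hall (min εR εs) (lt_min hεR hεs) (min_le_right _ _)
  exact hnone (min εR εs) (lt_min hεR hεs) (min_le_left _ _) α X₀ hα hNG

/-- **The two rung-M₂ leaves are contradictory (blow-up ⇒ ¬ break).**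
[cite: Tao2016AveragedNS, §4 Thm. 4.2 (statement shape); the two route files] -/
theorem not_target_of_rungTwoTarget (h : TaoLadderRungTwo.Target) : ¬ TaoLadderRungTwoBreak.Target :=
  fun hB => not_rungTwoTarget_of_target hB h

/-- **The opposing route is one leaf from its target.**  The uniform certificate crux K_A₂
(`TaoLadderRungTwo.ComparableGapCertificatesV2`) implies `TaoLadderRungTwo.Target` given the route's three CLOSED supports
`RestartControl`, `RestartGlue`, `LocalDynamicsSufficesAt` (discharged in the tree by `taoLadderRungTwo_restartControl_proof`,
`taoLadderRungTwo_restartGlue_proof`, `taoLadderRungTwo_localDynamicsSufficesAt_proof`; named hypotheses here for theses-cone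
hygiene), the perturbation crux being the in-file `GappedFrontRobustV2_holds`.
[cite: Tao2016AveragedNS, §4 Thm. 4.2, §5 (front steps); route TaoLadderRungTwo `closes`] -/
theorem rungTwoTarget_of_gapCertificatesV2 (h : TaoLadderRungTwo.ComparableGapCertificatesV2)
    (h₃ : TaoLadderRungTwo.RestartControl) (h₄ : TaoLadderRungTwo.RestartGlue)
    (h₅ : TaoLadderRungTwo.LocalDynamicsSufficesAt) : TaoLadderRungTwo.Target :=
  TaoLadderRungTwo.closes h TaoLadderRungTwo.GappedFrontRobustV2_holds h₃ h₄ h₅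

/-- **KILL TEST BY NAME for the deciding pair.**  `TaoLadderRungTwo.Target` refutes the conjunction of this route's two
cruxes ⟨20419⟩ `NoSurvivingEternalViscBddOne` and ⟨20420⟩ `EternalRigidityViscBddOne` (they close `TaoLadderRungTwoBreak.Target`).
[cite: Tao2016AveragedNS, §4 Thm. 4.2; route TaoLadderRungTwoBreak `closes`] -/
theorem not_pair_of_rungTwoTarget (h : TaoLadderRungTwo.Target) :
    ¬ (TaoLadderRungTwoBreak.NoSurvivingEternalViscBddOne ∧ TaoLadderRungTwoBreak.EternalRigidityViscBddOne) :=
  fun hp => not_target_of_rungTwoTarget h (TaoLadderRungTwoBreak.closes hp.1 hp.2)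

/-- **Disjunctive form.**  Under `TaoLadderRungTwo.Target`, at least one of ⟨20419⟩, ⟨20420⟩ is false.
[cite: Tao2016AveragedNS, §4 Thm. 4.2; route TaoLadderRungTwoBreak `closes`] -/
theorem rungTwoTarget_imp_not_or (h : TaoLadderRungTwo.Target) :
    ¬ TaoLadderRungTwoBreak.NoSurvivingEternalViscBddOne ∨ ¬ TaoLadderRungTwoBreak.EternalRigidityViscBddOne := by
  by_contra hc
  push Not at hc
  exact not_pair_of_rungTwoTarget h hc

/-- **The single open leaf of the opposing route kills the pair by name.**  K_A₂
(`TaoLadderRungTwo.ComparableGapCertificatesV2`: a uniform family of certified thin-tailed gap data for comparable tables of ONE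
fixed spread at EVERY small scale ratio), together with the three closed supports of its route, refutes
`NoSurvivingEternalViscBddOne ∧ EternalRigidityViscBddOne`.
[cite: Tao2016AveragedNS, §4 Thm. 4.2, §5; both route files] -/
theorem not_pair_of_gapCertificatesV2 (h : TaoLadderRungTwo.ComparableGapCertificatesV2)
    (h₃ : TaoLadderRungTwo.RestartControl) (h₄ : TaoLadderRungTwo.RestartGlue)
    (h₅ : TaoLadderRungTwo.LocalDynamicsSufficesAt) :
    ¬ (TaoLadderRungTwoBreak.NoSurvivingEternalViscBddOne ∧ TaoLadderRungTwoBreak.EternalRigidityViscBddOne) :=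
  not_pair_of_rungTwoTarget (rungTwoTarget_of_gapCertificatesV2 h h₃ h₄ h₅)

/-- **… and kills the split triple by name.**  K_A₂ refutes the conjunction of the split children (ρ0)
`NoSurvivingEternalBddOne`, (ρ+) `NoLoudLadderOne` and ⟨20420⟩ `EternalRigidityViscBddOne` (the children glue to ⟨20419⟩ pointwise in `R` by the tree's
`TaoCascade.noSurvivingEternalViscBddOne_of`, exactly as in the landed `taoLadderRungTwoBreak_noSurvivingEternalViscBddOneOfSplit_proof`).
[cite: Tao2016AveragedNS, §4 Thm. 4.2; route TaoLadderRungTwoBreak glued split] -/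
theorem not_split_of_gapCertificatesV2 (h : TaoLadderRungTwo.ComparableGapCertificatesV2)
    (h₃ : TaoLadderRungTwo.RestartControl) (h₄ : TaoLadderRungTwo.RestartGlue)
    (h₅ : TaoLadderRungTwo.LocalDynamicsSufficesAt) :
    ¬ (TaoLadderRungTwoBreak.NoSurvivingEternalBddOne ∧ TaoLadderRungTwoBreak.NoLoudLadderOne ∧
        TaoLadderRungTwoBreak.EternalRigidityViscBddOne) :=
  fun ht => not_pair_of_gapCertificatesV2 h h₃ h₄ h₅
    ⟨fun R hR => Literature.Analysis.FluidPDE.TaoCascade.noSurvivingEternalViscBddOne_of (ht.1 R hR) (ht.2.1 R hR),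
      ht.2.2⟩

/-- **… and the rev-1 pair.**  `TaoLadderRungTwo.Target` refutes `NoSurvivingDSSOne ∧ BlowupRigidityOne` (⟨20205⟩ ∧ ⟨20206⟩), which
close `TaoLadderRungTwoBreak.Target` by the rev-1 assembly (landed as `taoLadderRungTwoBreak_assembly_proof`; re-derived inline, thresholds
combined by `min`).
[cite: Tao2016AveragedNS, §4 Thm. 4.2; route TaoLadderRungTwoBreak `Assembly`] -/
theorem not_oldPair_of_rungTwoTarget (h : TaoLadderRungTwo.Target) :
    ¬ (TaoLadderRungTwoBreak.NoSurvivingDSSOne ∧ TaoLadderRungTwoBreak.BlowupRigidityOne) := by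
  rintro ⟨h₁, h₂⟩
  refine not_target_of_rungTwoTarget h fun R hR => ?_
  obtain ⟨ε₁, hε₁, H1⟩ := h₁ R hR
  obtain ⟨ε₂, hε₂, H2⟩ := h₂ R hR
  refine ⟨min ε₁ ε₂, lt_min hε₁ hε₂, fun ε₀ hε₀ hle α X₀ hα hNG => ?_⟩
  obtain ⟨q, π, T, Φ, hW, hS, r, x, hne⟩ := H2 ε₀ hε₀ (hle.trans (min_le_right _ _)) α X₀ hα hNG
  exact hne (H1 ε₀ hε₀ (hle.trans (min_le_left _ _)) α hα q π T Φ hW hS r x)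

/-- **Conversely: proving ⟨20419⟩ and ⟨20420⟩ refutes the opposing route's last open leaf by name** (given its three closed
supports).
[cite: Tao2016AveragedNS, §4 Thm. 4.2; both route files] -/
theorem not_gapCertificatesV2_of_pair (h₁ : TaoLadderRungTwoBreak.NoSurvivingEternalViscBddOne)
    (h₂ : TaoLadderRungTwoBreak.EternalRigidityViscBddOne)
    (h₃ : TaoLadderRungTwo.RestartControl) (h₄ : TaoLadderRungTwo.RestartGlue)
    (h₅ : TaoLadderRungTwo.LocalDynamicsSufficesAt) : ¬ TaoLadderRungTwo.ComparableGapCertificatesV2 :=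
  fun h => not_pair_of_gapCertificatesV2 h h₃ h₄ h₅ ⟨h₁, h₂⟩

end Summit.NavierStokesRegularity.NavierStokesRegularity.Theorems.TaoLadderRungTwoBreakDuel

end
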